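import Summits.HodgeConjecture.HodgeConjecture.Theorems.R90S4SplitFormGL                 -- ★ p862018 (dealer cand): `splitFormGL`, `coe_splitFormGL` (rfl), `cmDatum_splitFormGL`
import Summits.HodgeConjecture.HodgeConjecture.Theorems.R90S4EpsClassComapInvariant     -- ★ p861992: `isEpsClassAt_comap_cmTwistLocalEquiv_iff` (+ ★ p861794 NE lemmas, ★ `cmTwistLocalEquiv`, ★ C-defs)
import HarnessLib

/-!
# R90-TF · S4 · THEOREMS — `R90S4SplitFormHermitian`: the form of record `Φ₃ = splitForm L 3` is hermitian — the `hΦ` letter at `Φ := splitFormGL L`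

R90-TF section S4 = [Rogawski1990] Ch. 13.1–13.2 (dealer K2E2-plan (g6)); crux H413 (`stmt-HodgeConjecture-24833`), route `HCCMUnconditional`; item
S4#C-HERM (deal 2026-09-04T16:34:04Z (3), K2E3-p14 (g9)).  The ε-currency of FILE C (★ `epsLoc`, ★ `cmTwistLocalEquiv`, ★ `IsEpsFixedAt` ∕ `IsEpsClassAt` ∕
`IsTwistedCharLiftWith`, ★ p861888 `isEpsClassAt_oneDimGt_bcChar_det`, ★ p861794 ∕ p861992) carries the HERMITIAN binder
`hΦ : ((Φ : GL (Fin 3) L) : Matrix (Fin 3) (Fin 3) L)ᵀ.map (IsCMField.complexConj L) = (Φ : Matrix (Fin 3) (Fin 3) L)`; the kit of record lives at the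
quasi-split form `Φ₃ = splitForm L 3` (anti-diagonal with entries `0, 1`, ★ `F0P3InnerFormClassificationV6.splitForm`), packaged as ★ `splitFormGL L : GL (Fin 3) L`
(p862018).  This file PAYS that binder once — `splitFormGL_isHermitian` — and records the instantiated forms every Lines-C consumer would otherwise re-derive:
THE realisation `epsEquiv L v := cmTwistLocalEquiv L 3 (splitFormGL L) (splitFormGL_isHermitian L) v` (spelled out, no new definition), its defining
property, `ε_v ∘ ε_v = 1` at the form of record, and the `IsEpsFixedAt` ∕ `IsEpsClassAt` iff-forms with THE realisation.

PRINT.  §12.1 p. 171 ∕ §1.9: `Φ₃ = antidiag(1, 1, 1)` is hermitian, `ᵗΦ̄₃ = Φ₃`; §3.11 p. 34: `ε(g) = Φ ᵗḡ⁻¹ Φ⁻¹` is an involution.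

CONTENTS (all PROVED; no definition ∕ instance ∕ notation ∕ `sorry`; ★-only imports): `splitForm_transpose_map_complexConj` (every `N`), `splitForm_three_isHermitian`,
**`splitFormGL_isHermitian`** (the `hΦ` bytes at `Φ := splitFormGL L`), `isEpsRealisation_cmTwistLocalEquiv_splitFormGL`, `exists_isEpsRealisation_splitFormGL`,
`eq_cmTwistLocalEquiv_splitFormGL_of_isEpsRealisation`, `epsLoc_splitFormGL_epsLoc_splitFormGL` (`ε_v (ε_v g) = g`), `isEpsFixedAt_splitFormGL_iff`,
`isEpsFixedAt_splitFormGL_iff_nonempty`, `isEpsClassAt_comap_splitFormGL_iff`.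

## References
* [Rogawski1990] J. D. Rogawski, *Automorphic Representations of Unitary Groups in Three Variables*, Ann. of Math. Stud. 123 (1990), §12.1 p. 171 (`Φ₃`), §3.11
  p. 34 (`ε`), §12.4 p. 180 (`E_ε(G̃)`), §13.2 p. 200.
* [Mok2014] C. P. Mok, *Endoscopic classification of representations of quasi-split unitary groups*, Mem. AMS 235 (2015), §1 Notation p. 5 (`Φ_N` hermitian).
HONEST LABEL: HC_CM is proved only modulo the 7 printed citations until rung 0 closes; count-neutral helper.
-/

set_option autoImplicit false
set_option linter.dupNamespace false

noncomputable section

open MeasureTheory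
open scoped NumberField Matrix

namespace Summit.HodgeConjecture.HodgeConjecture.R90.S4

open Literature.NumberTheory.Automorphic
open IsDedekindDomain NumberField
open Summit.HodgeConjecture.HodgeConjecture.Cruxes.H413.F0P3InnerFormClassificationV6 (splitForm)

/-! ## §1 The form of record is hermitian -/

section Form

variable (L : Type) [Field L] [NumberField L] [IsCMField L]

/-- **`ᵗ(Φ̄_N) = Φ_N`** for the anti-diagonal form with entries `0, 1` (every `N`): `(splitForm L N)ᵀ.map c = splitForm L N` for the CM conjugation `c` (the
entries are fixed by any ring map, and the `0∕1` pattern `i + j + 1 = N` is symmetric). [cite: Mok2014, §1 Notation p. 5] [cite: Rogawski1990, §12.1 p. 171] -/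
theorem splitForm_transpose_map_complexConj (N : ℕ) : (splitForm L N)ᵀ.map (IsCMField.complexConj L) = splitForm L N := by
  ext i j
  simp only [Matrix.map_apply, Matrix.transpose_apply, Matrix.of_apply]
  by_cases h : i.val + j.val + 1 = N
  · rw [if_pos (by omega), if_pos h, map_one]
  · rw [if_neg (by omega), if_neg h, map_zero]

/-- **`Φ₃` is hermitian**: `(splitForm L 3)ᵀ.map c = splitForm L 3`. [cite: Rogawski1990, §12.1 p. 171] -/
theorem splitForm_three_isHermitian : (splitForm L 3)ᵀ.map (IsCMField.complexConj L) = splitForm L 3 :=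
  splitForm_transpose_map_complexConj L 3

/-- **THE `hΦ` LETTER AT THE FORM OF RECORD**: `((splitFormGL L : GL (Fin 3) L) : Matrix (Fin 3) (Fin 3) L)ᵀ.map c = ↑(splitFormGL L)` — EXACTLY the hermitian binder
of ★ `cmTwistLocalEquiv` ∕ ★ `isEpsFixedAt_iff_comap_cmTwistLocalEquiv_eq` ∕ ★ `isEpsClassAt_oneDimGt_bcChar_det` at `Φ := splitFormGL L` (`↑(splitFormGL L) = splitForm L 3`
reducibly, ★ `coe_splitFormGL`). [cite: Rogawski1990, §12.1 p. 171; §3.11 p. 34] -/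
theorem splitFormGL_isHermitian :
    ((splitFormGL L : GL (Fin 3) L) : Matrix (Fin 3) (Fin 3) L)ᵀ.map (IsCMField.complexConj L) = (splitFormGL L : Matrix (Fin 3) (Fin 3) L) :=
  splitForm_transpose_map_complexConj L 3

end Form

/-! ## §2 THE realisation of `ε_v` at the form of record and the instantiated `E_ε` forms -/

section Eps

variable (L : Type) [Field L] [NumberField L] [IsCMField L] (v : HeightOneSpectrum (𝓞 ↥(maximalRealSubfield L)))

/-- `cmTwistLocalEquiv L 3 (splitFormGL L) (splitFormGL_isHermitian L) v` IS a topological realisation of `ε_v` at the form of record (pointwise `rfl`).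
[cite: Rogawski1990, §3.11 p. 34; §12.4 p. 180] -/
theorem isEpsRealisation_cmTwistLocalEquiv_splitFormGL :
    IsEpsRealisation L (splitFormGL L) v (cmTwistLocalEquiv L 3 (splitFormGL L) (splitFormGL_isHermitian L) v) :=
  isEpsRealisation_cmTwistLocalEquiv L (splitFormGL L) (splitFormGL_isHermitian L) v

/-- **A realisation of `ε_v` EXISTS at the form of record** (the `∃ e, IsEpsRealisation …` clause of ★ `IsEpsFixedAt` ∕ ★ `IsTwistedCharLiftWith`, discharged with no
hypothesis left). [cite: Rogawski1990, §12.4 p. 180; §13.2 p. 200] -/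
theorem exists_isEpsRealisation_splitFormGL : ∃ e : GtLoc L v ≃ₜ* GtLoc L v, IsEpsRealisation L (splitFormGL L) v e :=
  ⟨_, isEpsRealisation_cmTwistLocalEquiv_splitFormGL L v⟩

/-- **Realisations are unique** at the form of record: any `e` with `IsEpsRealisation L (splitFormGL L) v e` IS `cmTwistLocalEquiv L 3 (splitFormGL L) _ v`.
[cite: Rogawski1990, §12.4 p. 180] -/
theorem eq_cmTwistLocalEquiv_splitFormGL_of_isEpsRealisation {e : GtLoc L v ≃ₜ* GtLoc L v} (he : IsEpsRealisation L (splitFormGL L) v e) :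
    e = cmTwistLocalEquiv L 3 (splitFormGL L) (splitFormGL_isHermitian L) v :=
  (isEpsRealisation_iff_eq_cmTwistLocalEquiv L (splitFormGL L) (splitFormGL_isHermitian L) v e).1 he

/-- **`ε_v ∘ ε_v = 1` at the form of record**: `epsLoc L (splitFormGL L) v (epsLoc L (splitFormGL L) v g) = g` (★ `twistLocal_twistLocal_cm` with the `hΦ` letter paid).
[cite: Rogawski1990, §3.11 p. 34] -/
theorem epsLoc_splitFormGL_epsLoc_splitFormGL (g : GtLoc L v) :
    epsLoc L (splitFormGL L) v (epsLoc L (splitFormGL L) v g) = g :=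
  twistLocal_twistLocal_cm L 3 (splitFormGL L) (splitFormGL_isHermitian L) v g

/-- **«`ε(π̃) ≅ π̃`» at the form of record, with THE realisation**: `IsEpsFixedAt L (splitFormGL L) v π̃ ↔ IrrClass.comap ε_v π̃ = π̃`. [cite: Rogawski1990, §12.4 p. 180] -/
theorem isEpsFixedAt_splitFormGL_iff (πt : IrrClass (GtLoc L v)) :
    IsEpsFixedAt L (splitFormGL L) v πt ↔ IrrClass.comap (cmTwistLocalEquiv L 3 (splitFormGL L) (splitFormGL_isHermitian L) v) πt = πt :=
  isEpsFixedAt_iff_comap_cmTwistLocalEquiv_eq L (splitFormGL L) (splitFormGL_isHermitian L) v πt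

/-- **«`ε(π̃) ≅ π̃`» iff a choice of `π̃(ε)` exists along THE realisation** (any measure). [cite: Rogawski1990, §12.4 p. 180; §13.2 p. 200] -/
theorem isEpsFixedAt_splitFormGL_iff_nonempty [MeasurableSpace (GtLoc L v)] (νGt : Measure (GtLoc L v)) (πt : IrrClass (GtLoc L v)) :
    IsEpsFixedAt L (splitFormGL L) v πt ↔ (twistedTraceSet πt νGt (cmTwistLocalEquiv L 3 (splitFormGL L) (splitFormGL_isHermitian L) v)).Nonempty :=
  isEpsFixedAt_iff_nonempty_cmTwistLocalEquiv L (splitFormGL L) (splitFormGL_isHermitian L) v νGt πt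

/-- **`E_ε(G̃_v)` is `ε`-stable at the form of record**: `IsEpsClassAt L (splitFormGL L) v (IrrClass.comap ε_v π̃) ↔ IsEpsClassAt L (splitFormGL L) v π̃`.
[cite: Rogawski1990, §12.4 p. 180] -/
theorem isEpsClassAt_comap_splitFormGL_iff (πt : IrrClass (GtLoc L v)) :
    IsEpsClassAt L (splitFormGL L) v (IrrClass.comap (cmTwistLocalEquiv L 3 (splitFormGL L) (splitFormGL_isHermitian L) v) πt) ↔
      IsEpsClassAt L (splitFormGL L) v πt :=
  isEpsClassAt_comap_cmTwistLocalEquiv_iff L (splitFormGL L) (splitFormGL_isHermitian L) v πt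

/-- For `π̃ ∈ E_ε(G̃_v)` at the form of record, `ε(π̃) = π̃` with THE realisation. [cite: Rogawski1990, §12.4 p. 180] -/
theorem IsEpsClassAt.comap_splitFormGL_eq {πt : IrrClass (GtLoc L v)} (h : IsEpsClassAt L (splitFormGL L) v πt) :
    IrrClass.comap (cmTwistLocalEquiv L 3 (splitFormGL L) (splitFormGL_isHermitian L) v) πt = πt :=
  h.comap_cmTwistLocalEquiv_eq L (splitFormGL L) (splitFormGL_isHermitian L) v

end Eps

end Summit.HodgeConjecture.HodgeConjecture.R90.S4

end
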